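import Literature.Barriers.QuantumAdvantage.UncorrectedNoiseMachineTuples
import Literature.Barriers.QuantumAdvantage.UncorrectedNoiseIQP
import Literature.Computability.Cryptography.QuantumCircuitDescFP
import HarnessLib

/-!
# The noisy-IQP simulating machine, III: reading the circuit description — gate codes and the four gate statistics

Support file for the discharge of `bremnerMontanaroShepherd2017_thm4`
(`Literature/Barriers/QuantumAdvantage/UncorrectedNoise.lean`). The exact Fourier coefficient
of an IQP circuit over `{Z, CZ, T}` is a product over the wires of table values indexed by the
statistics `t_i` (`T`-count of wire `i`), `λ_i(S)` (`CZ` partners of `i` inside `S`), and the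
sign needs `#Z on S`, `#CZ inside S` (`UncorrectedNoiseIQP.cubeFourierCoeff_iqpProb_eq_prod`,
`UncorrectedNoiseCoefficients.coefInt`). This file computes them, in the `FP`-brick algebra,
from the gate-list code `encList (gates.map QGate.encode)` that a uniform family writes
(`QCircuit.encode_eq_encList`, `QuantumCircuitDescFP.lean`):

* `countIfFn c` — the unary count of the items of a coded list passing a one-bit test
  (`countIfFn_boolPair`);
* the shape of gate codes (`encode_gate`: tag, `bin (opNum)`, unary arity, `encList` of binary
  wires) and accessors `opFn`, `w0Fn`, `w1Fn`, the op test `isOpFn k` (rejecting oracle gates),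
  unary wires against the ruler `1^N` (`w0UFn`, `w1UFn` via `binToUnaryFn`);
* the one-bit gate predicates `tPredFn`, `lamPredFn`, `zPredFn`, `czPredFn` in the context
  `statCtx N i T = ⟨1^N, ⟨1^i, T⟩⟩` and their truth on gates (`*_apply` = the Boolean syntax
  predicates `isTOn`, `isCZLam`, `isZOn`, `isCZIn`);
* the statistics `tCountFn`, `lamCntFn`, `zOnFn`, `czInFn` (all in `FP`) with values
  `1^{countP …}`, and `tCountW_eq_countP`, `czDeg_eq_countP`, `zOnShift_eq_countP`,
  `czInShift_eq_countP` identifying the counts with the statistics of `UncorrectedNoiseIQP.lean`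
  for the shift `tupleShift N l` read off the tuple.

## References

* [BremnerMontanaroShepherd2017] M. J. Bremner, A. Montanaro, D. J. Shepherd, *Achieving quantum
  supremacy with sparse and noisy commuting quantum computations*, Quantum 1 (2017) 8, §3.1.
* S. Arora, B. Barak, *Computational Complexity: A Modern Approach*, CUP 2009, §1.3.
-/

namespace Literature.Barriers.QuantumAdvantage.NoisyIQPMachine

open _root_.Computability Literature.Computability.Complexity Literature.Computability.Complexity.Brick
  Literature.Computability.Complexity.Plumb Literature.Computability.Cryptography

variable {N : ℕ}

/-! ### Counting the items of a coded list that pass a one-bit test -/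

/-- Fold step: bump the unary counter iff the item passes `c ⟨x, item⟩`. [folklore] -/
noncomputable def countStep (c : List Bool → List Bool) : List Bool → List Bool :=
  iteFn (itemTest c) (List.cons true ∘ sndF ∘ sndF) (sndF ∘ sndF)

/-- **`countIfFn c ⟨x, L⟩ = 1^{#{a ∈ L | c ⟨x, a⟩ = [1]}}`.** [cite: AroraBarak2009, §1.3 (bounded loops)] -/
noncomputable def countIfFn (c : List Bool → List Bool) : List Bool → List Bool :=
  foldFn (countStep c) (fun _ => [])

/-- `itemTest c` is one-bit for one-bit `c`. [folklore] -/
theorem oneBit_itemTest {c : List Bool → List Bool} (hc : OneBit c) : OneBit (itemTest c) := by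
  unfold itemTest; exact hc.comp _

/-- Growth of `countStep`. [folklore] -/
theorem foldGrowth_countStep {c : List Bool → List Bool} (hc : OneBit c) : FoldGrowth 1 (countStep c) := fun v => by
  unfold countStep
  rw [iteFn_of_oneBit (oneBit_itemTest hc)]
  split_ifs
  · simp; omega
  · simp only [Function.comp_apply]; omega

/-- `countIfFn c ∈ FP`. [cite: AroraBarak2009, §1.3] -/
theorem countIfFn_mem_FP {c : List Bool → List Bool} (hc : c ∈ FP) (h1 : OneBit c) : countIfFn c ∈ FP :=
  foldFn_mem_FP (iteFn_mem_FP (itemTest_mem_FP hc) (comp_mem_FP (cons_mem_FP true) (comp_mem_FP sndF_mem_FP sndF_mem_FP))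
    (comp_mem_FP sndF_mem_FP sndF_mem_FP)) (const_mem_FP _) (foldGrowth_countStep h1)

/-- The counting fold as a `foldl`. [folklore] -/
theorem foldl_countStep {c : List Bool → List Bool} (hc : OneBit c) (w : List Bool) : ∀ (l : List (List Bool)) (k : ℕ),
    l.foldl (fun acc a => countStep c (boolPair w (boolPair a acc))) (ones k) =
      ones (k + l.countP fun a => c (boolPair (fstF w) a) = [true])
  | [], k => by simp
  | a :: l, k => by
    rw [List.foldl_cons, List.countP_cons]
    obtain ⟨b, hb⟩ := hc (boolPair (fstF w) a)
    have hstep : countStep c (boolPair w (boolPair a (ones k))) = ones (k + if b = true then 1 else 0) := by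
      unfold countStep
      rw [iteFn_apply (b := b) (by rw [itemTest_apply, hb])]
      cases b <;> simp [ones, List.replicate_succ]
    rw [hstep, foldl_countStep hc w l, hb]
    congr 1
    cases b
    · simp
    · simp; omega

/-- **Value of `countIfFn`.** [folklore] -/
theorem countIfFn_boolPair {c : List Bool → List Bool} (hc : OneBit c) (x L : List Bool) :
    countIfFn c (boolPair x L) = ones ((decNil L).countP fun a => c (boolPair x a) = [true]) := by
  rw [countIfFn, foldFn_boolPair]
  have := foldl_countStep hc (boolPair x L) (decNil L) 0
  simpa using this

/-- `countIfFn` on a coded list of codes. [folklore] -/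
theorem countIfFn_encList {α : Type} {c : List Bool → List Bool} (hc : OneBit c) (x : List Bool) (enc : α → List Bool)
    (l : List α) : countIfFn c (boolPair x (encList (l.map enc))) = ones (l.countP fun a => c (boolPair x (enc a)) = [true]) := by
  rw [countIfFn_boolPair hc, decNil_encList, List.countP_map]; rfl

/-! ### Gate codes of the IQP gate set -/

/-- The numeric code of a gate symbol: `Z ↦ 0`, `CZ ↦ 1`, `T ↦ 2` (the `Encodable` instance of
`SamplingProblems.lean`). [folklore] -/
def opNum : IQPOp → ℕ
  | .Z => 0
  | .CZ => 1
  | .T => 2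

/-- `Encodable.encode` of a gate symbol is `opNum`. [folklore] -/
theorem encode_op (op : IQPOp) : Encodable.encode (op : iqpDiag.Op) = opNum op := by
  cases op <;> rfl

/-- The wire list of a placed gate symbol. [folklore] -/
noncomputable def wireList (op : IQPOp) (e : Fin (iqpDiag.arity op) ↪ Fin N) : List ℕ := List.ofFn fun i => (e i : ℕ)

/-- **The code of a placed gate symbol**: tag `0`, then `⟨bin (opNum), ⟨1^{arity}, encList (bin wires)⟩⟩`.
[folklore] -/
theorem encode_gate (op : IQPOp) (e : Fin (iqpDiag.arity op) ↪ Fin N) :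
    (QGate.gate op e : QGate iqpDiag N).encode =
      false :: boolPair (encodeNat (opNum op)) (boolPair (ones (iqpDiag.arity op)) (encList ((wireList op e).map encodeNat))) := by
  have h1 : Encodable.encode (op : iqpDiag.Op) = opNum op := encode_op op
  have h2 : encodingListNatBool.encode (wireList op e) =
      boolPair (unaryEncodeNat (wireList op e).length) (encList ((wireList op e).map encodeNat)) :=
    listBool_encode_eq_encList _ _
  show false :: boolPair (encodeNat (Encodable.encode (op : iqpDiag.Op))) (encodingListNatBool.encode (wireList op e)) = _
  rw [h1, h2, unaryEncodeNat_eq_replicate]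
  simp [wireList]

/-- The code of an oracle gate starts with the tag `1`. [folklore] -/
theorem encode_oracle (k : ℕ) (e : Fin (k + 1) ↪ Fin N) :
    ∃ rest : List Bool, (QGate.oracle k e : QGate iqpDiag N).encode = true :: rest := ⟨_, rfl⟩

/-- The wire list of a `Z` or `T` placement. [folklore] -/
theorem wireList_Z (e : Fin (iqpDiag.arity IQPOp.Z) ↪ Fin N) : wireList IQPOp.Z e = [(wire0 IQPOp.Z e : ℕ)] := rfl

/-- The wire list of a `T` placement. [folklore] -/
theorem wireList_T (e : Fin (iqpDiag.arity IQPOp.T) ↪ Fin N) : wireList IQPOp.T e = [(wire0 IQPOp.T e : ℕ)] := rfl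

/-- The wire list of a `CZ` placement. [folklore] -/
theorem wireList_CZ (e : Fin (iqpDiag.arity IQPOp.CZ) ↪ Fin N) :
    wireList IQPOp.CZ e = [(wire0 IQPOp.CZ e : ℕ), (wire1 e : ℕ)] := rfl

/-! ### Accessors of a gate code -/

/-- The op-code field `bin (opNum)` of a gate code (junk on other strings). [folklore] -/
def opFn : List Bool → List Bool := fstF ∘ List.tail

/-- The first wire field (binary). [folklore] -/
def w0Fn : List Bool → List Bool := nthF 2 ∘ List.tail

/-- The second wire field (binary; junk for one-wire gates). [folklore] -/
def w1Fn : List Bool → List Bool := nthF 3 ∘ List.tail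

/-- `opFn ∈ FP`. [folklore] -/
theorem opFn_mem_FP : opFn ∈ FP := comp_mem_FP fstF_mem_FP PRelSigma.tail_mem_FP

/-- `w0Fn ∈ FP`. [folklore] -/
theorem w0Fn_mem_FP : w0Fn ∈ FP := comp_mem_FP (nthF_mem_FP 2) PRelSigma.tail_mem_FP

/-- `w1Fn ∈ FP`. [folklore] -/
theorem w1Fn_mem_FP : w1Fn ∈ FP := comp_mem_FP (nthF_mem_FP 3) PRelSigma.tail_mem_FP

/-- `opFn` on a gate code. [folklore] -/
theorem opFn_gate (op : IQPOp) (e : Fin (iqpDiag.arity op) ↪ Fin N) :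
    opFn (QGate.gate op e : QGate iqpDiag N).encode = encodeNat (opNum op) := by
  rw [encode_gate]; simp [opFn]

/-- `w0Fn` on a gate code: the binary numeral of the first wire. [folklore] -/
theorem w0Fn_gate (op : IQPOp) (e : Fin (iqpDiag.arity op) ↪ Fin N) :
    w0Fn (QGate.gate op e : QGate iqpDiag N).encode = encodeNat (wire0 op e) := by
  rw [encode_gate]
  cases op <;> simp [w0Fn, nthF, wireList_Z, wireList_T, wireList_CZ, encList_cons]

/-- `w1Fn` on a `CZ` code: the binary numeral of the second wire. [folklore] -/
theorem w1Fn_gate_CZ (e : Fin (iqpDiag.arity IQPOp.CZ) ↪ Fin N) :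
    w1Fn (QGate.gate IQPOp.CZ e : QGate iqpDiag N).encode = encodeNat (wire1 e) := by
  rw [encode_gate]; simp [w1Fn, nthF, wireList_CZ, encList_cons]

/-- **The op test** `isOpFn k`: tag `0` and op-code `bin k` (one-bit on every string). [folklore] -/
noncomputable def isOpFn (k : ℕ) : List Bool → List Bool :=
  andFn (eqPairFn ∘ fanoutFn take1Fn (fun _ => [false])) (eqPairFn ∘ fanoutFn opFn (fun _ => encodeNat k))

/-- `isOpFn k` is one-bit. [folklore] -/
theorem oneBit_isOpFn (k : ℕ) : OneBit (isOpFn k) := oneBit_andFn (oneBit_eqPairFn.comp _) (oneBit_eqPairFn.comp _)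

/-- `isOpFn k ∈ FP`. [folklore] -/
theorem isOpFn_mem_FP (k : ℕ) : isOpFn k ∈ FP :=
  andFn_mem_FP (comp_mem_FP eqPairFn_mem_FP (fanoutFn_mem_FP take1Fn_mem_FP (const_mem_FP _)))
    (comp_mem_FP eqPairFn_mem_FP (fanoutFn_mem_FP opFn_mem_FP (const_mem_FP _)))

/-- `encodeNat` is injective on `opNum` values (all `< 3`). [folklore] -/
theorem encodeNat_opNum_eq_iff (op : IQPOp) (k : ℕ) : encodeNat (opNum op) = encodeNat k ↔ opNum op = k :=
  encodeNat_inj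

/-- **Value of the op test on a placed gate symbol.** [folklore] -/
theorem isOpFn_gate (k : ℕ) (op : IQPOp) (e : Fin (iqpDiag.arity op) ↪ Fin N) :
    isOpFn k (QGate.gate op e : QGate iqpDiag N).encode = [decide (opNum op = k)] := by
  unfold isOpFn
  rw [andFn_apply (b := true) (b' := decide (opNum op = k))]
  · rfl
  · rw [Function.comp_apply, fanoutFn_apply, encode_gate, eqPairFn_boolPair]; rfl
  · rw [Function.comp_apply, fanoutFn_apply, opFn_gate, eqPairFn_boolPair]
    congr 1
    rw [decide_eq_decide]
    exact encodeNat_opNum_eq_iff op k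

/-- **The op test rejects oracle gates.** [folklore] -/
theorem isOpFn_oracle (k k' : ℕ) (e : Fin (k' + 1) ↪ Fin N) :
    isOpFn k (QGate.oracle k' e : QGate iqpDiag N).encode = [false] := by
  obtain ⟨rest, hrest⟩ := encode_oracle (N := N) k' e
  obtain ⟨b', hb'⟩ := (oneBit_eqPairFn.comp (fanoutFn opFn (fun _ => encodeNat k))) (QGate.oracle k' e : QGate iqpDiag N).encode
  unfold isOpFn
  rw [andFn_apply (b := false) (b' := b') _ hb']
  · rfl
  · rw [Function.comp_apply, fanoutFn_apply, hrest, eqPairFn_boolPair]; rfl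

/-! ### Unary wires against a ruler, and the four gate statistics

Context of the statistics folds: `x = ⟨1^N, ⟨1^i, T⟩⟩` (ruler, current wire, tuple code of the
subset `S`); items are gate codes. -/

/-- The first wire of the item, in unary, capped by the ruler: `⟨x, a⟩ ↦ 1^{min ⟦w0 a⟧ N}`. [folklore] -/
noncomputable def w0UFn : List Bool → List Bool := binToUnaryFn ∘ fanoutFn (fstF ∘ fstF) (w0Fn ∘ sndF)

/-- The second wire of the item, in unary, capped by the ruler. [folklore] -/
noncomputable def w1UFn : List Bool → List Bool := binToUnaryFn ∘ fanoutFn (fstF ∘ fstF) (w1Fn ∘ sndF)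

/-- `w0UFn ∈ FP`. [folklore] -/
theorem w0UFn_mem_FP : w0UFn ∈ FP :=
  comp_mem_FP binToUnaryFn_mem_FP (fanoutFn_mem_FP (comp_mem_FP fstF_mem_FP fstF_mem_FP) (comp_mem_FP w0Fn_mem_FP sndF_mem_FP))

/-- `w1UFn ∈ FP`. [folklore] -/
theorem w1UFn_mem_FP : w1UFn ∈ FP :=
  comp_mem_FP binToUnaryFn_mem_FP (fanoutFn_mem_FP (comp_mem_FP fstF_mem_FP fstF_mem_FP) (comp_mem_FP w1Fn_mem_FP sndF_mem_FP))

/-- The context of the statistics folds: `⟨1^N, ⟨1^i, T⟩⟩`. [folklore] -/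
def statCtx (N i : ℕ) (T : List Bool) : List Bool := boolPair (ones N) (boolPair (ones i) T)

/-- `w0UFn` on a gate code in context. [folklore] -/
theorem w0UFn_gate (i : ℕ) (T : List Bool) (op : IQPOp) (e : Fin (iqpDiag.arity op) ↪ Fin N) :
    w0UFn (boolPair (statCtx N i T) (QGate.gate op e : QGate iqpDiag N).encode) = ones (wire0 op e) := by
  simp only [w0UFn, statCtx, Function.comp_apply, fanoutFn_apply, fstF_boolPair, sndF_boolPair, w0Fn_gate,
    binToUnaryFn_boolPair, bitsToNat_encodeNat, List.length_replicate]
  rw [min_eq_left (wire0 op e).2.le]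

/-- `w1UFn` on a `CZ` code in context. [folklore] -/
theorem w1UFn_gate_CZ (i : ℕ) (T : List Bool) (e : Fin (iqpDiag.arity IQPOp.CZ) ↪ Fin N) :
    w1UFn (boolPair (statCtx N i T) (QGate.gate IQPOp.CZ e : QGate iqpDiag N).encode) = ones (wire1 e) := by
  simp only [w1UFn, statCtx, Function.comp_apply, fanoutFn_apply, fstF_boolPair, sndF_boolPair, w1Fn_gate_CZ,
    binToUnaryFn_boolPair, bitsToNat_encodeNat, List.length_replicate]
  rw [min_eq_left (wire1 e).2.le]

/-- One-bit test: "the item's first wire is the current wire". [folklore] -/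
noncomputable def w0EqFn : List Bool → List Bool := eqPairFn ∘ fanoutFn w0UFn (fstF ∘ sndF ∘ fstF)

/-- One-bit test: "the item's second wire is the current wire". [folklore] -/
noncomputable def w1EqFn : List Bool → List Bool := eqPairFn ∘ fanoutFn w1UFn (fstF ∘ sndF ∘ fstF)

/-- One-bit test: "the item's first wire lies in `S`". [folklore] -/
noncomputable def w0MemFn : List Bool → List Bool := memTupleFn ∘ fanoutFn w0UFn (sndF ∘ sndF ∘ fstF)

/-- One-bit test: "the item's second wire lies in `S`". [folklore] -/
noncomputable def w1MemFn : List Bool → List Bool := memTupleFn ∘ fanoutFn w1UFn (sndF ∘ sndF ∘ fstF)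

/-- `w0EqFn ∈ FP`. [folklore] -/
theorem w0EqFn_mem_FP : w0EqFn ∈ FP :=
  comp_mem_FP eqPairFn_mem_FP (fanoutFn_mem_FP w0UFn_mem_FP (comp_mem_FP fstF_mem_FP (comp_mem_FP sndF_mem_FP fstF_mem_FP)))
/-- `w1EqFn ∈ FP`. [folklore] -/
theorem w1EqFn_mem_FP : w1EqFn ∈ FP :=
  comp_mem_FP eqPairFn_mem_FP (fanoutFn_mem_FP w1UFn_mem_FP (comp_mem_FP fstF_mem_FP (comp_mem_FP sndF_mem_FP fstF_mem_FP)))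
/-- `w0MemFn ∈ FP`. [folklore] -/
theorem w0MemFn_mem_FP : w0MemFn ∈ FP :=
  comp_mem_FP memTupleFn_mem_FP (fanoutFn_mem_FP w0UFn_mem_FP (comp_mem_FP sndF_mem_FP (comp_mem_FP sndF_mem_FP fstF_mem_FP)))
/-- `w1MemFn ∈ FP`. [folklore] -/
theorem w1MemFn_mem_FP : w1MemFn ∈ FP :=
  comp_mem_FP memTupleFn_mem_FP (fanoutFn_mem_FP w1UFn_mem_FP (comp_mem_FP sndF_mem_FP (comp_mem_FP sndF_mem_FP fstF_mem_FP)))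

/-- `w0EqFn` is one-bit. [folklore] -/
theorem oneBit_w0EqFn : OneBit w0EqFn := oneBit_eqPairFn.comp _
/-- `w1EqFn` is one-bit. [folklore] -/
theorem oneBit_w1EqFn : OneBit w1EqFn := oneBit_eqPairFn.comp _
/-- `w0MemFn` is one-bit. [folklore] -/
theorem oneBit_w0MemFn : OneBit w0MemFn := oneBit_memTupleFn.comp _
/-- `w1MemFn` is one-bit. [folklore] -/
theorem oneBit_w1MemFn : OneBit w1MemFn := oneBit_memTupleFn.comp _

section Values

variable (i : ℕ) (l : List ℕ)

/-- Value of `w0EqFn`. [folklore] -/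
theorem w0EqFn_gate (op : IQPOp) (e : Fin (iqpDiag.arity op) ↪ Fin N) :
    w0EqFn (boolPair (statCtx N i (tupleCode l)) (QGate.gate op e : QGate iqpDiag N).encode) =
      [decide ((wire0 op e : ℕ) = i)] := by
  rw [w0EqFn, Function.comp_apply, fanoutFn_apply, w0UFn_gate]
  simp only [statCtx, Function.comp_apply, fstF_boolPair, sndF_boolPair]
  exact eqPairFn_ones _ _

/-- Value of `w1EqFn` on a `CZ`. [folklore] -/
theorem w1EqFn_gate_CZ (e : Fin (iqpDiag.arity IQPOp.CZ) ↪ Fin N) :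
    w1EqFn (boolPair (statCtx N i (tupleCode l)) (QGate.gate IQPOp.CZ e : QGate iqpDiag N).encode) =
      [decide ((wire1 e : ℕ) = i)] := by
  rw [w1EqFn, Function.comp_apply, fanoutFn_apply, w1UFn_gate_CZ]
  simp only [statCtx, Function.comp_apply, fstF_boolPair, sndF_boolPair]
  exact eqPairFn_ones _ _

/-- Value of `w0MemFn`. [folklore] -/
theorem w0MemFn_gate (op : IQPOp) (e : Fin (iqpDiag.arity op) ↪ Fin N) :
    w0MemFn (boolPair (statCtx N i (tupleCode l)) (QGate.gate op e : QGate iqpDiag N).encode) =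
      [decide ((wire0 op e : ℕ) ∈ l)] := by
  rw [w0MemFn, Function.comp_apply, fanoutFn_apply, w0UFn_gate]
  simp only [statCtx, Function.comp_apply, fstF_boolPair, sndF_boolPair]
  exact memTupleFn_apply _ _

/-- Value of `w1MemFn` on a `CZ`. [folklore] -/
theorem w1MemFn_gate_CZ (e : Fin (iqpDiag.arity IQPOp.CZ) ↪ Fin N) :
    w1MemFn (boolPair (statCtx N i (tupleCode l)) (QGate.gate IQPOp.CZ e : QGate iqpDiag N).encode) =
      [decide ((wire1 e : ℕ) ∈ l)] := by
  rw [w1MemFn, Function.comp_apply, fanoutFn_apply, w1UFn_gate_CZ]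
  simp only [statCtx, Function.comp_apply, fstF_boolPair, sndF_boolPair]
  exact memTupleFn_apply _ _

end Values

/-! ### The four gate predicates and their truth on gates -/

/-- `[item is a T on the current wire]`. [folklore] -/
noncomputable def tPredFn : List Bool → List Bool := andFn (isOpFn 2 ∘ sndF) w0EqFn

/-- `[item is a CZ at the current wire whose other wire lies in S]`. [folklore] -/
noncomputable def lamPredFn : List Bool → List Bool :=
  andFn (isOpFn 1 ∘ sndF) (orFn (andFn w0EqFn w1MemFn) (andFn w1EqFn w0MemFn))

/-- `[item is a Z on a wire of S]`. [folklore] -/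
noncomputable def zPredFn : List Bool → List Bool := andFn (isOpFn 0 ∘ sndF) w0MemFn

/-- `[item is a CZ with both wires in S]`. [folklore] -/
noncomputable def czPredFn : List Bool → List Bool := andFn (isOpFn 1 ∘ sndF) (andFn w0MemFn w1MemFn)

/-- `tPredFn ∈ FP`. [folklore] -/
theorem tPredFn_mem_FP : tPredFn ∈ FP := andFn_mem_FP (comp_mem_FP (isOpFn_mem_FP 2) sndF_mem_FP) w0EqFn_mem_FP
/-- `lamPredFn ∈ FP`. [folklore] -/
theorem lamPredFn_mem_FP : lamPredFn ∈ FP :=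
  andFn_mem_FP (comp_mem_FP (isOpFn_mem_FP 1) sndF_mem_FP)
    (orFn_mem_FP (andFn_mem_FP w0EqFn_mem_FP w1MemFn_mem_FP) (andFn_mem_FP w1EqFn_mem_FP w0MemFn_mem_FP))
/-- `zPredFn ∈ FP`. [folklore] -/
theorem zPredFn_mem_FP : zPredFn ∈ FP := andFn_mem_FP (comp_mem_FP (isOpFn_mem_FP 0) sndF_mem_FP) w0MemFn_mem_FP
/-- `czPredFn ∈ FP`. [folklore] -/
theorem czPredFn_mem_FP : czPredFn ∈ FP :=
  andFn_mem_FP (comp_mem_FP (isOpFn_mem_FP 1) sndF_mem_FP) (andFn_mem_FP w0MemFn_mem_FP w1MemFn_mem_FP)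

/-- `tPredFn` is one-bit. [folklore] -/
theorem oneBit_tPredFn : OneBit tPredFn := oneBit_andFn ((oneBit_isOpFn 2).comp _) oneBit_w0EqFn
/-- `lamPredFn` is one-bit. [folklore] -/
theorem oneBit_lamPredFn : OneBit lamPredFn :=
  oneBit_andFn ((oneBit_isOpFn 1).comp _)
    (oneBit_orFn (oneBit_andFn oneBit_w0EqFn oneBit_w1MemFn) (oneBit_andFn oneBit_w1EqFn oneBit_w0MemFn))
/-- `zPredFn` is one-bit. [folklore] -/
theorem oneBit_zPredFn : OneBit zPredFn := oneBit_andFn ((oneBit_isOpFn 0).comp _) oneBit_w0MemFn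
/-- `czPredFn` is one-bit. [folklore] -/
theorem oneBit_czPredFn : OneBit czPredFn :=
  oneBit_andFn ((oneBit_isOpFn 1).comp _) (oneBit_andFn oneBit_w0MemFn oneBit_w1MemFn)

/-! The mathematical gate predicates (on the syntax of `QGate iqpDiag N`). -/
section Predicates

variable (i : ℕ) (l : List ℕ)

/-- `g` is a `T` on wire `i`. [folklore] -/
def isTOn : QGate iqpDiag N → Bool
  | .gate .T e => decide ((wire0 IQPOp.T e : ℕ) = i)
  | _ => false

/-- `g` is a `CZ` at wire `i` whose other wire lies in the tuple `l`. [folklore] -/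
def isCZLam : QGate iqpDiag N → Bool
  | .gate .CZ e => (decide ((wire0 IQPOp.CZ e : ℕ) = i) && decide ((wire1 e : ℕ) ∈ l)) ||
      (decide ((wire1 e : ℕ) = i) && decide ((wire0 IQPOp.CZ e : ℕ) ∈ l))
  | _ => false

/-- `g` is a `Z` on a wire of `l`. [folklore] -/
def isZOn : QGate iqpDiag N → Bool
  | .gate .Z e => decide ((wire0 IQPOp.Z e : ℕ) ∈ l)
  | _ => false

/-- `g` is a `CZ` with both wires in `l`. [folklore] -/
def isCZIn : QGate iqpDiag N → Bool
  | .gate .CZ e => decide ((wire0 IQPOp.CZ e : ℕ) ∈ l) && decide ((wire1 e : ℕ) ∈ l)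
  | _ => false

/-- A predicate built as `andFn (isOpFn k ∘ sndF) rest` rejects oracle gates and gates with
another symbol. [folklore] -/
theorem andFn_isOpFn_of_ne {k : ℕ} {rest : List Bool → List Bool} (hrest : OneBit rest) (x : List Bool)
    (g : QGate iqpDiag N) (hg : ∀ op e, g = QGate.gate op e → opNum op ≠ k) :
    andFn (isOpFn k ∘ sndF) rest (boolPair x g.encode) = [false] := by
  obtain ⟨b', hb'⟩ := hrest (boolPair x g.encode)
  rw [andFn_apply (b := false) (b' := b') _ hb']
  · rfl
  · rw [Function.comp_apply, sndF_boolPair]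
    cases g with
    | gate op e => rw [isOpFn_gate, decide_eq_false (hg op e rfl)]
    | oracle k' e => exact isOpFn_oracle k k' e

/-- **Truth of `tPredFn`.** [folklore] -/
theorem tPredFn_apply (g : QGate iqpDiag N) :
    tPredFn (boolPair (statCtx N i (tupleCode l)) g.encode) = [isTOn i g] := by
  unfold tPredFn
  match g with
  | .gate .T e =>
    rw [andFn_apply (b := true) (b' := decide ((wire0 IQPOp.T e : ℕ) = i))]
    · rfl
    · rw [Function.comp_apply, sndF_boolPair, isOpFn_gate]; rfl
    · exact w0EqFn_gate i l IQPOp.T e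
  | .gate .Z e => exact andFn_isOpFn_of_ne oneBit_w0EqFn _ _ (by rintro op e' ⟨⟩; decide)
  | .gate .CZ e => exact andFn_isOpFn_of_ne oneBit_w0EqFn _ _ (by rintro op e' ⟨⟩; decide)
  | .oracle k e => exact andFn_isOpFn_of_ne oneBit_w0EqFn _ _ (by rintro op e' ⟨⟩)

/-- **Truth of `lamPredFn`.** [folklore] -/
theorem lamPredFn_apply (g : QGate iqpDiag N) :
    lamPredFn (boolPair (statCtx N i (tupleCode l)) g.encode) = [isCZLam i l g] := by
  unfold lamPredFn
  match g with
  | .gate .CZ e =>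
    rw [andFn_apply (b := true) (b' := isCZLam i l (QGate.gate IQPOp.CZ e))]
    · rfl
    · rw [Function.comp_apply, sndF_boolPair, isOpFn_gate]; rfl
    · rw [orFn_apply (andFn_apply (w0EqFn_gate i l IQPOp.CZ e) (w1MemFn_gate_CZ i l e))
        (andFn_apply (w1EqFn_gate_CZ i l e) (w0MemFn_gate i l IQPOp.CZ e))]
      rfl
  | .gate .Z e => exact andFn_isOpFn_of_ne (oneBit_orFn (oneBit_andFn oneBit_w0EqFn oneBit_w1MemFn)
      (oneBit_andFn oneBit_w1EqFn oneBit_w0MemFn)) _ _ (by rintro op e' ⟨⟩; decide)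
  | .gate .T e => exact andFn_isOpFn_of_ne (oneBit_orFn (oneBit_andFn oneBit_w0EqFn oneBit_w1MemFn)
      (oneBit_andFn oneBit_w1EqFn oneBit_w0MemFn)) _ _ (by rintro op e' ⟨⟩; decide)
  | .oracle k e => exact andFn_isOpFn_of_ne (oneBit_orFn (oneBit_andFn oneBit_w0EqFn oneBit_w1MemFn)
      (oneBit_andFn oneBit_w1EqFn oneBit_w0MemFn)) _ _ (by rintro op e' ⟨⟩)

/-- **Truth of `zPredFn`.** [folklore] -/
theorem zPredFn_apply (g : QGate iqpDiag N) :
    zPredFn (boolPair (statCtx N i (tupleCode l)) g.encode) = [isZOn l g] := by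
  unfold zPredFn
  match g with
  | .gate .Z e =>
    rw [andFn_apply (b := true) (b' := decide ((wire0 IQPOp.Z e : ℕ) ∈ l))]
    · rfl
    · rw [Function.comp_apply, sndF_boolPair, isOpFn_gate]; rfl
    · exact w0MemFn_gate i l IQPOp.Z e
  | .gate .T e => exact andFn_isOpFn_of_ne oneBit_w0MemFn _ _ (by rintro op e' ⟨⟩; decide)
  | .gate .CZ e => exact andFn_isOpFn_of_ne oneBit_w0MemFn _ _ (by rintro op e' ⟨⟩; decide)
  | .oracle k e => exact andFn_isOpFn_of_ne oneBit_w0MemFn _ _ (by rintro op e' ⟨⟩)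

/-- **Truth of `czPredFn`.** [folklore] -/
theorem czPredFn_apply (g : QGate iqpDiag N) :
    czPredFn (boolPair (statCtx N i (tupleCode l)) g.encode) = [isCZIn l g] := by
  unfold czPredFn
  match g with
  | .gate .CZ e =>
    rw [andFn_apply (b := true) (b' := isCZIn l (QGate.gate IQPOp.CZ e))]
    · rfl
    · rw [Function.comp_apply, sndF_boolPair, isOpFn_gate]; rfl
    · rw [andFn_apply (w0MemFn_gate i l IQPOp.CZ e) (w1MemFn_gate_CZ i l e)]; rfl
  | .gate .Z e => exact andFn_isOpFn_of_ne (oneBit_andFn oneBit_w0MemFn oneBit_w1MemFn) _ _ (by rintro op e' ⟨⟩; decide)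
  | .gate .T e => exact andFn_isOpFn_of_ne (oneBit_andFn oneBit_w0MemFn oneBit_w1MemFn) _ _ (by rintro op e' ⟨⟩; decide)
  | .oracle k e => exact andFn_isOpFn_of_ne (oneBit_andFn oneBit_w0MemFn oneBit_w1MemFn) _ _ (by rintro op e' ⟨⟩)

end Predicates

/-! ### The statistics as counts, and their values -/

/-- **`tCountFn`**: on `⟨⟨1^N, ⟨1^i, T⟩⟩, encList (gate codes)⟩`, the unary `T`-count of wire `i`.
[folklore] -/
noncomputable def tCountFn : List Bool → List Bool := countIfFn tPredFn
/-- **`lamCntFn`**: the unary number of `CZ` partners of wire `i` inside `S`. [folklore] -/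
noncomputable def lamCntFn : List Bool → List Bool := countIfFn lamPredFn
/-- **`zOnFn`**: the unary number of `Z` gates on `S`. [folklore] -/
noncomputable def zOnFn : List Bool → List Bool := countIfFn zPredFn
/-- **`czInFn`**: the unary number of `CZ` gates inside `S`. [folklore] -/
noncomputable def czInFn : List Bool → List Bool := countIfFn czPredFn

/-- `tCountFn ∈ FP`. [folklore] -/
theorem tCountFn_mem_FP : tCountFn ∈ FP := countIfFn_mem_FP tPredFn_mem_FP oneBit_tPredFn
/-- `lamCntFn ∈ FP`. [folklore] -/
theorem lamCntFn_mem_FP : lamCntFn ∈ FP := countIfFn_mem_FP lamPredFn_mem_FP oneBit_lamPredFn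
/-- `zOnFn ∈ FP`. [folklore] -/
theorem zOnFn_mem_FP : zOnFn ∈ FP := countIfFn_mem_FP zPredFn_mem_FP oneBit_zPredFn
/-- `czInFn ∈ FP`. [folklore] -/
theorem czInFn_mem_FP : czInFn ∈ FP := countIfFn_mem_FP czPredFn_mem_FP oneBit_czPredFn

section StatValues

variable (i : ℕ) (l : List ℕ) (L : List (QGate iqpDiag N))

/-- Value of `tCountFn`. [folklore] -/
theorem tCountFn_apply : tCountFn (boolPair (statCtx N i (tupleCode l)) (encList (L.map QGate.encode))) =
    ones (L.countP (isTOn i)) := by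
  rw [tCountFn, countIfFn_encList oneBit_tPredFn]
  simp_rw [tPredFn_apply]; simp

/-- Value of `lamCntFn`. [folklore] -/
theorem lamCntFn_apply : lamCntFn (boolPair (statCtx N i (tupleCode l)) (encList (L.map QGate.encode))) =
    ones (L.countP (isCZLam i l)) := by
  rw [lamCntFn, countIfFn_encList oneBit_lamPredFn]
  simp_rw [lamPredFn_apply]; simp

/-- Value of `zOnFn`. [folklore] -/
theorem zOnFn_apply : zOnFn (boolPair (statCtx N i (tupleCode l)) (encList (L.map QGate.encode))) =
    ones (L.countP (isZOn l)) := by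
  rw [zOnFn, countIfFn_encList oneBit_zPredFn]
  simp_rw [zPredFn_apply]; simp

/-- Value of `czInFn`. [folklore] -/
theorem czInFn_apply : czInFn (boolPair (statCtx N i (tupleCode l)) (encList (L.map QGate.encode))) =
    ones (L.countP (isCZIn l)) := by
  rw [czInFn, countIfFn_encList oneBit_czPredFn]
  simp_rw [czPredFn_apply]; simp

end StatValues

/-! ### The counts are the statistics of `UncorrectedNoiseIQP` -/

/-- `tCountW` as a count. [folklore] -/
theorem tCountW_eq_countP (i : Fin N) : ∀ L : List (QGate iqpDiag N), tCountW L i = L.countP (isTOn (i : ℕ))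
  | [] => rfl
  | QGate.gate IQPOp.T e :: L => by
    rw [tCountW, List.countP_cons, tCountW_eq_countP i L]
    simp only [isTOn, Fin.val_inj, decide_eq_true_eq]
  | QGate.gate IQPOp.Z _ :: L => by rw [tCountW, List.countP_cons, tCountW_eq_countP i L]; simp [isTOn]
  | QGate.gate IQPOp.CZ _ :: L => by rw [tCountW, List.countP_cons, tCountW_eq_countP i L]; simp [isTOn]
  | QGate.oracle _ _ :: L => by rw [tCountW, List.countP_cons, tCountW_eq_countP i L]; simp [isTOn]

/-- The shift read through a tuple: `s w = [w ∈ l]`. [folklore] -/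
def tupleShift (N : ℕ) (l : List ℕ) : QReg N := fun w => decide ((w : ℕ) ∈ l)

/-- `czDeg` as a count. [folklore] -/
theorem czDeg_eq_countP (l : List ℕ) (i : Fin N) : ∀ L : List (QGate iqpDiag N),
    czDeg L (tupleShift N l) i = L.countP (isCZLam (i : ℕ) l)
  | [] => rfl
  | QGate.gate IQPOp.CZ e :: L => by
    rw [czDeg, List.countP_cons, czDeg_eq_countP l i L, add_assoc]
    congr 1
    have hne := wire0_ne_wire1 e
    simp only [isCZLam, tupleShift, Fin.val_inj, decide_eq_true_eq, Bool.or_eq_true, Bool.and_eq_true]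
    by_cases h0 : wire0 IQPOp.CZ e = i <;> by_cases h1 : wire1 e = i <;>
      by_cases m0 : ((wire0 IQPOp.CZ e : ℕ)) ∈ l <;> by_cases m1 : ((wire1 e : ℕ)) ∈ l <;>
      simp [h0, h1, m0, m1] <;> omega
  | QGate.gate IQPOp.Z _ :: L => by rw [czDeg, List.countP_cons, czDeg_eq_countP l i L]; simp [isCZLam]
  | QGate.gate IQPOp.T _ :: L => by rw [czDeg, List.countP_cons, czDeg_eq_countP l i L]; simp [isCZLam]
  | QGate.oracle _ _ :: L => by rw [czDeg, List.countP_cons, czDeg_eq_countP l i L]; simp [isCZLam]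

/-- `zOnShift` as a count. [folklore] -/
theorem zOnShift_eq_countP (l : List ℕ) : ∀ L : List (QGate iqpDiag N), zOnShift L (tupleShift N l) = L.countP (isZOn l)
  | [] => rfl
  | QGate.gate IQPOp.Z e :: L => by
    rw [zOnShift, List.countP_cons, zOnShift_eq_countP l L]
    simp [isZOn, tupleShift]
  | QGate.gate IQPOp.T _ :: L => by rw [zOnShift, List.countP_cons, zOnShift_eq_countP l L]; simp [isZOn]
  | QGate.gate IQPOp.CZ _ :: L => by rw [zOnShift, List.countP_cons, zOnShift_eq_countP l L]; simp [isZOn]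
  | QGate.oracle _ _ :: L => by rw [zOnShift, List.countP_cons, zOnShift_eq_countP l L]; simp [isZOn]

/-- `czInShift` as a count. [folklore] -/
theorem czInShift_eq_countP (l : List ℕ) : ∀ L : List (QGate iqpDiag N), czInShift L (tupleShift N l) = L.countP (isCZIn l)
  | [] => rfl
  | QGate.gate IQPOp.CZ e :: L => by
    rw [czInShift, List.countP_cons, czInShift_eq_countP l L]
    simp [isCZIn, tupleShift]
  | QGate.gate IQPOp.Z _ :: L => by rw [czInShift, List.countP_cons, czInShift_eq_countP l L]; simp [isCZIn]
  | QGate.gate IQPOp.T _ :: L => by rw [czInShift, List.countP_cons, czInShift_eq_countP l L]; simp [isCZIn]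
  | QGate.oracle _ _ :: L => by rw [czInShift, List.countP_cons, czInShift_eq_countP l L]; simp [isCZIn]

end Literature.Barriers.QuantumAdvantage.NoisyIQPMachine
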